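import Mathlib
import HarnessLib
import Summits.QuantumFields.YangMills.Theses.ScalingWindowSplit
import Summits.QuantumFields.YangMills.Theorems.SelfNormalisedSkewness.Negative.SelfNormalisedSkewnessFalseWithoutFloor
import Summits.QuantumFields.YangMills.Theorems.SelfNormalisedMomentBoundsR.Negative.FloorFalseOfSubsingleton
import Summits.QuantumFields.YangMills.Theorems.GapAtCorrelationLength.Negative.GapAtCorrelationLengthFalseWithoutNonabelian
import Summits.QuantumFields.YangMills.Theorems.ContinuumLegGivenGap.Negative.PerGroupBurden

/-!
# `SelfNormalisedSkewnessGapped` (stmt-QuantumFields-18170) — negative lemma: the volume-uniform lattice GAP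
# does not exclude c-number junk; the polynomial FLOOR stays load-bearing

Crux W₂ᴳ = `ScalingWindowSplit.SelfNormalisedSkewnessGapped` is the repaired W₂ (`SelfNormalisedSkewness`,
stmt-QuantumFields-18944, refuted-misstated): the same skewness floor under ONE more hypothesis, W₁'s
volume-uniform lattice mass gap `0 < Δ → HasLatticeMassGap r sch Δ`.  Refuter's birth vetting of W₂ᴳ
(crux-attack, 2026-08-17) kernel-certifies the junk analysis of the NEW clause:

* `hasLatticeMassGap_of_subsingleton` — on a SUBSINGLETON gauge group every configuration space is a
  point, every connected time-correlation vanishes (the tree's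
  `ContinuumLegGivenGap.Negative.latticeConnectedCorr_subsingleton`), and therefore
  `HasLatticeMassGap r sch Δ` holds for EVERY scheme and EVERY `Δ` (constant `C = 0`): the summit's gap
  interface has the trivial group as a junk model;
* `kappa3_eq_zero_of_subsingleton` — the (self-normalised or not) third cumulant of the curvature vanishes
  identically there (every lattice `n`-point function is a product of constants, the tree's
  `GapAtCorrelationLength.Negative.latticeSchwinger_of_subsingleton`; the bare truncated two-point function
  vanishes by `SelfNormalisedMomentBoundsR.Negative.trunc_eq_zero_of_subsingleton`);
* `SelfNormalisedSkewnessGappedWithoutFloor` is W₂ᴳ with the floor conjunct `(sch.a k) ^ p ≤ T u k` deleted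
  (everything else verbatim, the idle binder `p` dropped), and
  `selfNormalisedSkewnessGapped_false_without_floor` refutes it UNCONDITIONALLY with the c-number witness
  `G = PUnit`, `r = trivialLatticeRep`, `sch = linearCouplingScheme` (`a_k = 1/(k+1)`, `L_k = (k+1)²`,
  `β_k = k`), `u = 0`, `M = 0`, `Δ = 1`: weak coupling, the gap (by the first bullet), polynomial volumes,
  past support and the window `0 ≤ 0 · 0` hold while every third cumulant is `0 < δ`.

Hence ANY proof of W₂ᴳ must use the floor: the gap clause alone does not separate the trivial group (with
the floor the same witness is a vacuous instance, `a_k ^ p > 0 = T⁰`, exactly as for U_R —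
`SelfNormalisedMomentBoundsR.Negative.floor_false_of_subsingleton`).  No positive instance of a Theses decl
is asserted.  No `sorry`; axioms `propext`, `Classical.choice`, `Quot.sound`.
-/

noncomputable section

open scoped SchwartzMap BigOperators Topology
open MeasureTheory Filter Topology
open Literature.MathematicalPhysics.AQFT Literature.MathematicalPhysics.QuantumLattice
open Literature.MathematicalPhysics.QuantumFieldTheory
open Summit.QuantumFields.YangMills.Theorems.SelfNormalisedSkewness.Negative
  (trivialLatticeRep linearCouplingScheme linearCouplingScheme_hasWeakCouplingLimit
    linearCouplingScheme_polyVolume)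
open Summit.QuantumFields.YangMills.Theorems.SelfNormalisedMomentBoundsR.Negative (trunc_eq_zero_of_subsingleton)
open Summit.QuantumFields.YangMills.Theorems.GapAtCorrelationLength.Negative (latticeSchwinger_of_subsingleton)
open Summit.QuantumFields.YangMills.Theorems.ContinuumLegGivenGap.Negative (latticeConnectedCorr_subsingleton)

namespace Summit.QuantumFields.YangMills.Theorems.SelfNormalisedSkewnessGapped.Negative

variable {G : Type} [Group G] [TopologicalSpace G] [IsTopologicalGroup G] [CompactSpace G]
  [MeasurableSpace G] [BorelSpace G]

/-- **The summit's volume-uniform lattice gap has the trivial group as a junk model**: for a subsingleton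
`G`, `HasLatticeMassGap r sch Δ` holds for every scheme `sch` and every `Δ` (constant `C = 0`).
[folklore] -/
theorem hasLatticeMassGap_of_subsingleton [Subsingleton G] (r : LatticeRep G) {ι : Type}
    (sch : SpeciesScheme ι) (Δ : ℝ) : HasLatticeMassGap r sch Δ := by
  intro A B
  refine ⟨0, Filter.Eventually.of_forall fun k S _ n _ => ?_⟩
  rw [latticeConnectedCorr_subsingleton, abs_zero, zero_mul]

/-- **Subsingleton group ⇒ the third cumulant of the curvature field vanishes** for every scheme `S`
(in particular for the self-normalised scheme `canon`, whatever its constants), every `k` and every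
triple of tests: the joint-cumulant polynomial of deterministic variables is identically zero. [folklore] -/
theorem kappa3_eq_zero_of_subsingleton [Subsingleton G] (r : LatticeRep G)
    (S : SpeciesScheme (YMSpecies G)) (k : ℕ) (f g h : 𝓢(EuclideanSpace ℝ (Fin 4), ℝ)) :
    latticeSchwinger r.ρ S (fun s => s.F) k 3 (fun _ => r.curvature) ![f, g, h] -
      latticeSchwinger r.ρ S (fun s => s.F) k 1 (fun _ => r.curvature) ![f] *
        latticeSchwinger r.ρ S (fun s => s.F) k 2 (fun _ => r.curvature) ![g, h] -
      latticeSchwinger r.ρ S (fun s => s.F) k 1 (fun _ => r.curvature) ![g] *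
        latticeSchwinger r.ρ S (fun s => s.F) k 2 (fun _ => r.curvature) ![f, h] -
      latticeSchwinger r.ρ S (fun s => s.F) k 1 (fun _ => r.curvature) ![h] *
        latticeSchwinger r.ρ S (fun s => s.F) k 2 (fun _ => r.curvature) ![f, g] +
      2 * (latticeSchwinger r.ρ S (fun s => s.F) k 1 (fun _ => r.curvature) ![f] *
        latticeSchwinger r.ρ S (fun s => s.F) k 1 (fun _ => r.curvature) ![g] *
        latticeSchwinger r.ρ S (fun s => s.F) k 1 (fun _ => r.curvature) ![h]) = 0 := by
  simp only [latticeSchwinger_of_subsingleton r S k _ _ _ (fun _ => 1), Fin.prod_univ_succ,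
    Fin.prod_univ_zero, Matrix.cons_val_zero, Matrix.cons_val_succ, mul_one]
  ring

/-- **W₂ᴳ without its floor** (the MUTATED crux statement refuted below — a hypothesis-shaped `Prop` of
this negative lemma, deliberately carrying no citation tag: it is NOT a literature fact, it is false, and
it must stay in this file).  Verbatim `ScalingWindowSplit.SelfNormalisedSkewnessGapped` with the conjunct
`(sch.a k) ^ p ≤ T u k` of the floor-and-window hypothesis deleted (and the then idle binder `p` dropped);
the gap clause `0 < Δ → HasLatticeMassGap r sch Δ →` is KEPT. -/
def SelfNormalisedSkewnessGappedWithoutFloor : Prop :=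
  let E := EuclideanSpace ℝ (Fin 4); ∀ (G : Type) [Group G] [TopologicalSpace G] [IsTopologicalGroup G] [CompactSpace G] [MeasurableSpace G] [BorelSpace G] (r : LatticeRep G) (sch : SpeciesScheme (YMSpecies G)) (u : SchwartzMap E ℝ) (M Δ : ℝ), let bare : SpeciesScheme (YMSpecies G) := { sch with c := fun _ _ => 1, m := fun _ _ => 0 }; let T : SchwartzMap E ℝ → ℕ → ℝ := fun w k => latticeSchwinger r.ρ bare (fun s => s.F) k (1 + 1) (fun _ => r.curvature) ![w, thetaTest 4 w] - latticeSchwinger r.ρ bare (fun s => s.F) k 1 (fun _ => r.curvature) ![w] * latticeSchwinger r.ρ bare (fun s => s.F) k 1 (fun _ => r.curvature) ![thetaTest 4 w]; let canon : SpeciesScheme (YMSpecies G) := { sch with c := fun _ k => (Real.sqrt (T u k))⁻¹, m := fun _ k => ∫ U, r.curvature.F (torusLift (sch.side k) U) ∂(wilsonMeasure r.ρ (sch.β k)) }; sch.HasWeakCouplingLimit → 0 < Δ → HasLatticeMassGap r sch Δ → (∃ N : ℕ, 1 ≤ N ∧ ∀ᶠ k in Filter.atTop, (sch.a k)⁻¹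 ≤ (sch.a k * (sch.L k : ℝ)) ^ N) → tsupport u ⊆ {y : E | y 0 < 0} → (∀ᶠ k in Filter.atTop, T u k ≤ M * T (timeShiftTest 4 (-1) u) k) → ∃ (f g h : SchwartzMap E ℝ) (δ : ℝ), Disjoint (tsupport f) (tsupport g) ∧ Disjoint (tsupport f) (tsupport h) ∧ Disjoint (tsupport g) (tsupport h) ∧ 0 < δ ∧ ∀ᶠ k in Filter.atTop, δ ≤ |latticeSchwinger r.ρ canon (fun s => s.F) k 3 (fun _ => r.curvature) ![f, g, h] - latticeSchwinger r.ρ canon (fun s => s.F) k 1 (fun _ => r.curvature) ![f] * latticeSchwinger r.ρ canon (fun s => s.F) k 2 (fun _ => r.curvature) ![g, h] - latticeSchwinger r.ρ canon (fun s => s.F) k 1 (fun _ => r.curvature) ![g] * latticeSchwinger r.ρ canon (fun s => s.F) k 2 (fun _ => r.curvature) ![f, h] - latticeSchwinger r.ρ canon (fun s => s.F) k 1 (fun _ => r.curvature) ![h] * latticeSchwinger r.ρ canon (fun s => s.F) k 2 (fun _ => r.curvature) ![f, g] + 2 * (latticeSchwinger r.ρ canon (fun s => s.F) k 1 (fun _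 => r.curvature) ![f] * latticeSchwinger r.ρ canon (fun s => s.F) k 1 (fun _ => r.curvature) ![g] * latticeSchwinger r.ρ canon (fun s => s.F) k 1 (fun _ => r.curvature) ![h])|

/-- **The floor is load-bearing even under the gap: W₂ᴳ without it is false** (unconditionally).
Witness: `G = PUnit`, `r = trivialLatticeRep`, `sch = linearCouplingScheme`, `u = 0`, `M = 0`, `Δ = 1`;
weak coupling, the volume-uniform gap (`hasLatticeMassGap_of_subsingleton`), polynomial volumes, past
support and the window `0 ≤ 0 · 0` hold, every third cumulant is `0 < δ`. [folklore] -/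
theorem selfNormalisedSkewnessGapped_false_without_floor : ¬ SelfNormalisedSkewnessGappedWithoutFloor := by
  intro h
  have hsupp : tsupport ((0 : 𝓢(EuclideanSpace ℝ (Fin 4), ℝ)) : EuclideanSpace ℝ (Fin 4) → ℝ) ⊆
      {y : EuclideanSpace ℝ (Fin 4) | y 0 < 0} := by
    intro y hy
    rw [show ((0 : 𝓢(EuclideanSpace ℝ (Fin 4), ℝ)) : EuclideanSpace ℝ (Fin 4) → ℝ) = 0 from rfl,
      tsupport_eq_empty_iff.2 rfl] at hy
    exact hy.elim
  obtain ⟨f, g, h₃, δ, -, -, -, hδ, hev⟩ :=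
    h PUnit trivialLatticeRep (linearCouplingScheme _) 0 0 1
      (linearCouplingScheme_hasWeakCouplingLimit _) one_pos
      (hasLatticeMassGap_of_subsingleton trivialLatticeRep (linearCouplingScheme _) 1)
      (linearCouplingScheme_polyVolume _) hsupp
      (Filter.Eventually.of_forall fun k => by
        beta_reduce
        rw [trunc_eq_zero_of_subsingleton, trunc_eq_zero_of_subsingleton, mul_zero])
  obtain ⟨k, hk⟩ := hev.exists
  rw [kappa3_eq_zero_of_subsingleton, abs_zero] at hk
  exact absurd hk (not_le.2 hδ)

end Summit.QuantumFields.YangMills.Theorems.SelfNormalisedSkewnessGapped.Negative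

end
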